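import Summits.CriticalPhenomena.CardyFormulaZ2.Theorems.CardyComplexConeEdgePrecompactUFRSArmDomination

/-!
# Arm domination, the doubly marked residual, Part A: the translate's interface loop through a deep corner
(line `qkz-strip-boundary-arm` of crux `CardyComplexCone.EdgePrecompact`, stmt-CriticalPhenomena-11387;
helper file for the registered residual sub-goal `ufrs_doublyMarkedCase_cert` of the corrected item
(H₁) `ufrs_armDomination2` of the road map for the uniform forward response stability "UFRS", see
the module docstrings of `…UFRSArmDominationResiduals.lean` and `…UFRSArmDominationFreeTail.lean`;
the residual itself is closed in `…UFRSDoublyMarked.lean`, which imports this file)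

Setting: `E` admissible, `β₁ = (shiftData E w).bcBondConfig ω` the completed configuration of the
translate, `a'` the start corner of the translate whose `β₁`-orbit `O₁ a'` sits in an inner face of
the translate at time `K` and not at time `K + 1`, and a corner `x₀` all of whose vertex's faces are
inner for the translate (a "deep" corner) which is none of `O₁ a' 0, …, O₁ a' K`. In the doubly
marked residual `x₀ = O₀ a n` is the deep re-entry corner of the good first stretch of `E`, which is
off the translate's exploration `O₁ a' [0, k + T]` (its corners have targets off the ball or are
free-tail corners), and the second LONG strand of the certificate is read off the loop below by
planar duality carried out combinatorially (backward agreement with the first stretch down to a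
collar discrepancy, see Part B).

* `translateLoop_DM` (registered) — the `β₁`-orbit `Λ` of `x₀` never leaves the inner faces of the
  translate: an exit happens at THE exit corner of the translate (`runEnd_exitType_W3H` +
  `exitCorner_unique`), which is the end `O₁ a' K` of the translate's exploration; but then either
  `x₀` would be an earlier corner of that exploration (iterated injectivity of the successor map,
  `cornerOrbit_start_cancel_DM`), or the exploration's start corner `a'` would be reached from an
  inner face (`nextCorner_ne_start`). Hence, the inner corners being finitely many
  (`finite_innerCorners`) and the successor map injective, `Λ` is PERIODIC with a least period
  `L > 0` over which its corners are pairwise distinct (a simple loop).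
* `dist_meshPoint_le_of_mem_cTgt_DM`, `dist_meshPoint_le_of_mem_cSrc_DM` — one-mesh bookkeeping.

References: S. Smirnov, C. R. Acad. Sci. Paris 333 (2001), §2 (exploration path, its exit at
`e_b`); G. Grimmett, *Percolation* (1999), §11.2; P. Nolin, Electron. J. Probab. 13 (2008), §4.
-/

set_option linter.unusedVariables false

namespace Summit.CriticalPhenomena.CardyFormulaZ2.Cruxes.EdgePrecompact.QkzStripBoundaryArm

open MeasureTheory Filter Set Metric
open scoped Topology BigOperators Pointwise
open Literature.Probability.LatticeModels Literature.Probability.Percolation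
open Literature.Probability.RandomPlanarGeometry (DobrushinDomain)
open Summit.CriticalPhenomena.CardyFormulaZ2.Theses.CardyComplexCone

noncomputable section

/-! ## Orbit bookkeeping -/

/-- Iterated injectivity of the successor map across different starts: two orbits which agree at
time `t` started at the same corner. -/
theorem cornerOrbit_start_cancel_DM {β : BondConfig (Site 2)} {x y : Site 2 × Fin 4} (t : ℕ)
    (h : cornerOrbit β x t = cornerOrbit β y t) : x = y := by
  induction t with
  | zero => exact h
  | succ t ih =>
    have h' : nextCorner β (cornerOrbit β x t) = nextCorner β (cornerOrbit β y t) := h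
    exact ih (nextCorner_injective h')

/-- A site on the target edge of a corner is within one mesh of its vertex. -/
theorem dist_meshPoint_le_of_mem_cTgt_DM {δ : ℝ} (hδ : 0 ≤ δ) {p : Site 2 × Fin 4} {y : Site 2}
    (hy : y ∈ cTgt p) : dist (meshPoint δ y) (meshPoint δ p.1) ≤ δ := by
  have h : y = p.1 ∨ y = p.1 + cornerUnit (p.2 + 1) := Sym2.mem_iff.1 hy
  rcases h with rfl | rfl
  · rw [dist_self]; exact hδ
  · rw [dist_meshPoint_add_cornerUnit_eq, abs_of_nonneg hδ]

/-- A site on the source edge of a corner is within one mesh of its vertex. -/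
theorem dist_meshPoint_le_of_mem_cSrc_DM {δ : ℝ} (hδ : 0 ≤ δ) {p : Site 2 × Fin 4} {y : Site 2}
    (hy : y ∈ cSrc p) : dist (meshPoint δ y) (meshPoint δ p.1) ≤ δ := by
  have h : y = p.1 ∨ y = p.1 + cornerUnit p.2 := Sym2.mem_iff.1 hy
  rcases h with rfl | rfl
  · rw [dist_self]; exact hδ
  · rw [dist_meshPoint_add_cornerUnit_eq, abs_of_nonneg hδ]

/-! ## The interface loop of the translate through a deep corner -/

/-- **The translate's orbit of a deep corner off the translate's exploration is a simple loop
through inner faces** (registered sub-goal `translateLoop_DM`). For admissible `E`, the start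
corner `a'` of `shiftData E w` whose completed orbit sits in an inner face at time `K` and not at
time `K + 1` (so `O₁ a' K` is THE exit corner of the translate, `runEnd_exitType_W3H`), and a corner
`x₀` all of whose vertex's faces are inner for the translate and which is none of
`O₁ a' 0, …, O₁ a' K`: the `β₁`-orbit of `x₀` stays in inner faces of the translate forever (it
could only leave at the exit corner `O₁ a' K`, `exitCorner_unique`; then either `x₀` would be an
earlier corner of the exploration, or the exploration's start corner `a'` would be reached from an
inner face, `nextCorner_ne_start`), and it is periodic with a period `L > 0` over which its corners
are pairwise distinct (finitely many inner corners, injective successor map). -/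
theorem translateLoop_DM : ∀ (E : DiscreteDobrushin), E.IsZdAdmissible → ∀ (ω : BondConfig (Site 2)) (w : Site 2) (a' x₀ : Site 2 × Fin 4) (K : ℕ), (shiftData E w).IsStartCorner a' → (shiftData E w).IsInnerFace (cFace (cornerOrbit ((shiftData E w).bcBondConfig ω) a' K)) → ¬ (shiftData E w).IsInnerFace (cFace (cornerOrbit ((shiftData E w).bcBondConfig ω) a' (K + 1))) → (∀ f, IsCorner x₀.1 f → (shiftData E w).IsInnerFace f) → (∀ s ≤ K, x₀ ≠ cornerOrbit ((shiftData E w).bcBondConfig ω) a' s) → (∀ t, (shiftData E w).IsInnerFace (cFace (cornerOrbit ((shiftData E w).bcBondConfig ω) x₀ t))) ∧ ∃ L : ℕ, 0 < L ∧ cornerOrbit ((shiftData E w).bcBondConfig ω) x₀ L = x₀ ∧ ∀ s t, s < t → t < L → cornerOrbit ((shiftData E w).bcBondConfig ω) x₀ s ≠ cornerOrbit ((shiftData E w).bcBondConfig ω) x₀ t := by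
  classical
  intro E hE ω w a' x₀ K ha' hKin hKout hdeep hx₀
  have hE₁ : (shiftData E w).IsZdAdmissible := isZdAdmissible_shiftData E w hE
  have hgood : a'.1 ∉ (shiftData E w).zdArcB ∨ ∀ f, IsCorner a'.1 f → (shiftData E w).IsInnerFace f :=
    Or.inl (fun hB => Set.disjoint_left.1 hE₁.disjoint ha'.mem_zdArcA hB)
  obtain ⟨-, hqA, hqB, hqIn, -⟩ := runEnd_exitType_W3H hE ω w hKin hKout hgood
  -- the orbit never leaves the inner faces
  have hinner : ∀ t, ∀ t' ≤ t, (shiftData E w).IsInnerFace (cFace (cornerOrbit ((shiftData E w).bcBondConfig ω) x₀ t')) := by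
    intro t
    induction t with
    | zero =>
      intro t' ht'
      obtain rfl : t' = 0 := Nat.le_zero.1 ht'
      exact hdeep _ (isCorner_cFace x₀)
    | succ t ih =>
      intro t' ht'
      rcases Nat.lt_or_ge t' (t + 1) with hlt | hge
      · exact ih t' (by omega)
      · have ht'eq : t' = t + 1 := le_antisymm ht' hge
        rw [ht'eq]
        by_contra hout
        obtain ⟨-, hA, hB, hIn, -⟩ := runEnd_exitType_W3H hE ω w (a' := x₀) (K := t) (ih t le_rfl) hout (Or.inr hdeep)
        have heq : cornerOrbit ((shiftData E w).bcBondConfig ω) x₀ t = cornerOrbit ((shiftData E w).bcBondConfig ω) a' K :=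
          exitCorner_unique hE₁ hA hB hIn hqA hqB hqIn
        rcases le_or_gt t K with htK | htK
        · refine hx₀ (K - t) (Nat.sub_le _ _) (cornerOrbit_start_cancel_DM (β := ((shiftData E w).bcBondConfig ω)) t ?_)
          rw [heq, ← cornerOrbit_add_eq, Nat.sub_add_cancel htK]
        · obtain ⟨d, rfl⟩ : ∃ d, t = d + 1 + K := ⟨t - K - 1, by omega⟩
          have h1 : cornerOrbit ((shiftData E w).bcBondConfig ω) x₀ (d + 1) = a' := by
            refine cornerOrbit_start_cancel_DM (β := ((shiftData E w).bcBondConfig ω)) K ?_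
            rw [← cornerOrbit_add_eq, heq]
          exact nextCorner_ne_start hE₁ ha' (ih d (by omega)) h1
  have hall : ∀ t, (shiftData E w).IsInnerFace (cFace (cornerOrbit ((shiftData E w).bcBondConfig ω) x₀ t)) :=
    fun t => hinner t t le_rfl
  refine ⟨hall, ?_⟩
  -- finitely many inner corners: the orbit repeats, hence is periodic from the start
  obtain ⟨i, j, hij, hEq⟩ := (finite_innerCorners hE₁).exists_lt_map_eq_of_forall_mem
    (f := cornerOrbit ((shiftData E w).bcBondConfig ω) x₀) hall
  have hex : ∃ L, 0 < L ∧ cornerOrbit ((shiftData E w).bcBondConfig ω) x₀ L = x₀ := by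
    refine ⟨j - i, by omega, ?_⟩
    have h := cornerOrbit_add_right_cancel ((shiftData E w).bcBondConfig ω) x₀ (a := 0) (b := j - i) i
      (by rw [zero_add, Nat.sub_add_cancel hij.le]; exact hEq)
    exact h.symm
  refine ⟨Nat.find hex, (Nat.find_spec hex).1, (Nat.find_spec hex).2, fun s t hst htL h => ?_⟩
  have h0 : cornerOrbit ((shiftData E w).bcBondConfig ω) x₀ 0 = cornerOrbit ((shiftData E w).bcBondConfig ω) x₀ (t - s) :=
    cornerOrbit_add_right_cancel ((shiftData E w).bcBondConfig ω) x₀ (a := 0) (b := t - s) s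
      (by rw [zero_add, Nat.sub_add_cancel hst.le]; exact h)
  exact Nat.find_min hex (m := t - s) (by omega) ⟨by omega, h0.symm⟩

end

end Summit.CriticalPhenomena.CardyFormulaZ2.Cruxes.EdgePrecompact.QkzStripBoundaryArm
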